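import Literature.MathematicalPhysics.QuantumFieldTheory.Balaban1983to89.B5Ineq1101QGQTorus
import HarnessLib

/-!
# NE7StraightSliceB5Green — row NE7 (node U5), the (A)-bill's XL(c) docking, file D5 (iv′) of `t4/b2b-balaban-t4-ne7-p2/g84/XLC-DOCKING-MEMO.md` §8:
# BAŁABAN's CONSTRAINED GREEN FIELD `GJ − GQ*(QGQ*)⁻¹QGJ` (`G = Δ_a⁻¹` (1.71)) LIES IN `ker Q_k` AND SOLVES `Δ_a`'s CONSTRAINED WEAK EQUATION — IN lit-balaban's SYMBOLS,
# with `QGQ*` invertible by lit-balaban's (1.100)–(1.101) lower bound `γ_E·I ≤ QGQ*`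

Lineage `b2b-balaban-t4-ne7-p2` (CRUX PROVER NE7 #2, co-owner of row NE7), generation 84.  A module ENTIRELY IN lit-balaban's SYMBOLS over `B5Ineq1101QGQTorus`
(`QGQ_sub_smul_one_posSemidef : γ_E·I ≤ Q(Δ_a)⁻¹Q*`, `gammaE_pos`), `B5Eq199QGQTorus` (`QGQ_isHermitian`), `B5DeltaA169` (`DeltaA`, `QvAdj = n^d·Qᴴ`, `isUnit_DeltaA`),
`B5Block118.QvOp`; it is (140) `NE7ConstrainedGreenIdentity` (abstract, Mathlib-only) SPECIALISED to Bałaban's operators, written out directly on matrices.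
WHAT ([folklore] linear algebra; [cite: Balaban1984PropagatorsI, (1.71) p.30, (1.100)–(1.102) p.34]).  §1 `QGQ_posDef`: `D := Q_k(Δ_a)⁻¹Q*_k` is positive definite
(`0 < a`), `isUnit_QGQ`, `QGQ_mul_inv` (`D·D⁻¹ = I`).  §2 `cGreen n M a := (Δ_a)⁻¹ − (Δ_a)⁻¹Q*D⁻¹Q(Δ_a)⁻¹` — the matrix of the constrained Green operator («−ω = (QGQ*)⁻¹B»,
(1.102), at `B = QGJ`); **`QvOp_mul_cGreen`**: `Q·C = 0` (its fields lie in `ker Q_k`); **`DeltaA_mul_cGreen`**: `Δ_a·C = I − Q*D⁻¹Q(Δ_a)⁻¹`; **`form_DeltaA_cGreen`**: for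
`β ∈ ker Q_k`, `⟨β, Δ_a(CJ)⟩ = ⟨β, J⟩` (the correction is in `range Q*`, which pairs to zero against `ker Q`).  So `C = cGreen` is a «constrained solution operator» in the
sense of (147) `NE7StraightSliceB5Transfer.rankOneSourceSolver_of_solutionOperator`: the (A)-bill's XL(c) is thereby EXACTLY the sup → sup bound
`|∂_n(cGreen·J)|_∞ ≤ K(d,L,a)·|J|_∞` on `Tor (fine L^(k+1) (N,…,N))`, uniformly in `k, N` — lit-balaban's (1.115)₂ territory (the OWNER's).
HONEST FRAMING (page 1): [folklore] linear algebra on Bałaban's typed operators; NO estimate; nothing of Bałaban's asserted beyond lit-balaban's typed (1.71)∕(1.100)∕(1.101);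
NOT (APE), NOT ONE-STEP, NOT NE7; spine 0∕9; finite T⁴ rung (B)+1 — NOT infinite volume, NOT mass gap, NOT Clay.  Continuum YM on T⁴ ⇐ BetaPertH ∧ nine spine estimates
(0/9 proved); BetaPertH ⇐ (D1) ∧ (D4) ∧ CAP+tail; G-an2-4 gates asym, D1 and NE2/3/4.
-/

set_option autoImplicit false

open scoped BigOperators Matrix ComplexConjugate ComplexOrder
open Finset

namespace Summit.QuantumFields.BalabanUV.T4Continuum.NE7StraightSliceB5Green

open Literature.MathematicalPhysics.QuantumFieldTheory.Balaban1983to89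
open B5Prop11Plancherel (Tor fine)
open B5Action121 (star_mulVec_dotProduct)
open B5Block118 (QvOp)
open B5DeltaA169 (DeltaA QvAdj isUnit_DeltaA)
open B5Ineq1101QGQTorus (QGQ_sub_smul_one_posSemidef gammaE_pos)
open B5Eq199QGQTorus (QGQ_isHermitian)
open T4GaugeActionRate (gam0)

noncomputable section

variable {d : ℕ} (n : ℕ) [NeZero n] (M : Fin d → ℕ) [hM : ∀ μ, NeZero (M μ)] (a : ℝ)

/-! ## §1 `QGQ*` is positive definite, hence invertible -/

/-- **`Q(Δ_a)⁻¹Q*` IS POSITIVE DEFINITE** (`0 < a`): lit-balaban's uniform lower bound `γ_E·I ≤ QGQ*` ((1.100)–(1.101)) with `γ_E > 0`.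
[cite: Balaban1984PropagatorsI, (1.100)–(1.101) p.34] -/
theorem QGQ_posDef (ha : 0 < a) : (QvOp n M * (DeltaA n M a)⁻¹ * QvAdj n M).PosDef := by
  refine Matrix.PosDef.of_dotProduct_mulVec_pos (QGQ_isHermitian n M a ha) fun x hx => ?_
  have hγ := gammaE_pos (d := d) a ha
  have h := (QGQ_sub_smul_one_posSemidef n M a ha).dotProduct_mulVec_nonneg x
  rw [Matrix.sub_mulVec, dotProduct_sub, Matrix.smul_mulVec, Matrix.one_mulVec, dotProduct_smul, smul_eq_mul, sub_nonneg] at h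
  refine lt_of_lt_of_le ?_ h
  have hxx : 0 < star x ⬝ᵥ x := by
    rw [Matrix.dotProduct_star_self_pos_iff]
    exact hx
  exact mul_pos (by exact_mod_cast hγ) hxx

/-- `Q(Δ_a)⁻¹Q*` is invertible. [cite: Balaban1984PropagatorsI, (1.102) p.34] -/
theorem isUnit_QGQ (ha : 0 < a) : IsUnit (QvOp n M * (DeltaA n M a)⁻¹ * QvAdj n M) :=
  (QGQ_posDef n M a ha).isUnit

/-- `D·D⁻¹ = I` for `D = Q(Δ_a)⁻¹Q*`. [folklore] -/
theorem QGQ_mul_inv (ha : 0 < a) :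
    (QvOp n M * (DeltaA n M a)⁻¹ * QvAdj n M) * (QvOp n M * (DeltaA n M a)⁻¹ * QvAdj n M)⁻¹ = 1 :=
  Matrix.mul_nonsing_inv _ ((Matrix.isUnit_iff_isUnit_det _).mp (isUnit_QGQ n M a ha))

/-- `Δ_a·(Δ_a)⁻¹ = I`. [cite: Balaban1984PropagatorsI, (1.71) p.30] -/
theorem DeltaA_mul_inv (hn : 1 ≤ n) (ha : 0 < a) : DeltaA n M a * (DeltaA n M a)⁻¹ = 1 :=
  Matrix.mul_nonsing_inv _ ((Matrix.isUnit_iff_isUnit_det _).mp (isUnit_DeltaA n hn M a ha))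

/-! ## §2 The constrained Green operator of `Δ_a` on `ker Q_k` -/

/-- **THE CONSTRAINED GREEN OPERATOR** `C = G − GQ*(QGQ*)⁻¹QG`, `G = (Δ_a)⁻¹`: the matrix form of (140)'s `constrainedGreen` at Bałaban's operators ((1.102): the
correction `−GQ*ω`, `−ω = (QGQ*)⁻¹QGJ`, enforcing `Q(CJ) = 0`). [cite: Balaban1984PropagatorsI, (1.102) p.34] -/
def cGreen : Matrix (Tor (fine n M) × Fin d) (Tor (fine n M) × Fin d) ℂ :=
  (DeltaA n M a)⁻¹ - (DeltaA n M a)⁻¹ * QvAdj n M * (QvOp n M * (DeltaA n M a)⁻¹ * QvAdj n M)⁻¹ * QvOp n M * (DeltaA n M a)⁻¹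

/-- **`Q·C = 0`**: the constrained Green fields lie in `ker Q_k`. [cite: Balaban1984PropagatorsI, (1.102) p.34] -/
theorem QvOp_mul_cGreen (ha : 0 < a) : QvOp n M * cGreen n M a = 0 := by
  have h := QGQ_mul_inv n M a ha
  rw [cGreen, Matrix.mul_sub]
  have e : QvOp n M * ((DeltaA n M a)⁻¹ * QvAdj n M * (QvOp n M * (DeltaA n M a)⁻¹ * QvAdj n M)⁻¹ * QvOp n M * (DeltaA n M a)⁻¹)
      = (QvOp n M * (DeltaA n M a)⁻¹ * QvAdj n M) * (QvOp n M * (DeltaA n M a)⁻¹ * QvAdj n M)⁻¹ * (QvOp n M * (DeltaA n M a)⁻¹) := by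
    simp only [Matrix.mul_assoc]
  rw [e, h, Matrix.one_mul, sub_self]

/-- `Q(CJ) = 0` for every source `J`. [cite: Balaban1984PropagatorsI, (1.102) p.34] -/
theorem QvOp_mulVec_cGreen (ha : 0 < a) (J : Tor (fine n M) × Fin d → ℂ) : QvOp n M *ᵥ (cGreen n M a *ᵥ J) = 0 := by
  rw [Matrix.mulVec_mulVec, QvOp_mul_cGreen n M a ha, Matrix.zero_mulVec]

/-- **`Δ_a·C = I − Q*(QGQ*)⁻¹QG`**: the constrained Green field solves `Δ_a A = J` up to a correction in `range Q*`. [cite: Balaban1984PropagatorsI, (1.71) p.30, (1.102) p.34] -/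
theorem DeltaA_mul_cGreen (hn : 1 ≤ n) (ha : 0 < a) :
    DeltaA n M a * cGreen n M a = 1 - QvAdj n M * (QvOp n M * (DeltaA n M a)⁻¹ * QvAdj n M)⁻¹ * QvOp n M * (DeltaA n M a)⁻¹ := by
  have h := DeltaA_mul_inv n M a hn ha
  rw [cGreen, Matrix.mul_sub, h]
  have e : DeltaA n M a * ((DeltaA n M a)⁻¹ * QvAdj n M * (QvOp n M * (DeltaA n M a)⁻¹ * QvAdj n M)⁻¹ * QvOp n M * (DeltaA n M a)⁻¹)
      = (DeltaA n M a * (DeltaA n M a)⁻¹) * (QvAdj n M * (QvOp n M * (DeltaA n M a)⁻¹ * QvAdj n M)⁻¹ * QvOp n M * (DeltaA n M a)⁻¹) := by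
    simp only [Matrix.mul_assoc]
  rw [e, h, Matrix.one_mul]

/-- `range Q*` pairs to zero against `ker Q`: `⟨β, Q*w⟩ = n^d·⟨Qβ, w⟩ = 0` for `Qβ = 0`. [cite: Balaban1984PropagatorsI, (1.21) p.21] -/
theorem dotProduct_QvAdj_mulVec_of_ker {β : Tor (fine n M) × Fin d → ℂ} (hβ : QvOp n M *ᵥ β = 0) (w : Tor M × Fin d → ℂ) :
    star β ⬝ᵥ (QvAdj n M *ᵥ w) = 0 := by
  rw [QvAdj, Matrix.smul_mulVec, dotProduct_smul, ← star_mulVec_dotProduct, hβ, star_zero, zero_dotProduct, smul_zero]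

/-- **THE CONSTRAINED GREEN FIELD SOLVES `Δ_a`'s CONSTRAINED WEAK EQUATION**: `⟨β, Δ_a(CJ)⟩ = ⟨β, J⟩` for every `β ∈ ker Q_k` and every `J` (`1 ≤ n`, `0 < a`).
[cite: Balaban1984PropagatorsI, (1.102) p.34] -/
theorem form_DeltaA_cGreen (hn : 1 ≤ n) (ha : 0 < a) (J : Tor (fine n M) × Fin d → ℂ) {β : Tor (fine n M) × Fin d → ℂ} (hβ : QvOp n M *ᵥ β = 0) :
    star β ⬝ᵥ (DeltaA n M a *ᵥ (cGreen n M a *ᵥ J)) = star β ⬝ᵥ J := by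
  rw [Matrix.mulVec_mulVec, DeltaA_mul_cGreen n M a hn ha, Matrix.sub_mulVec, Matrix.one_mulVec, dotProduct_sub]
  simp only [Matrix.mul_assoc, ← Matrix.mulVec_mulVec]
  rw [dotProduct_QvAdj_mulVec_of_ker n M hβ, sub_zero]

/-- `C` is a constrained solution operator of `Δ_a` on `ker Q_k`, in the two clauses consumed by (147) `rankOneSourceSolver_of_solutionOperator`. [folklore] -/
theorem cGreen_solutionOperator (hn : 1 ≤ n) (ha : 0 < a) :
    (∀ J : Tor (fine n M) × Fin d → ℂ, QvOp n M *ᵥ (cGreen n M a *ᵥ J) = 0)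
      ∧ ∀ (J β : Tor (fine n M) × Fin d → ℂ), QvOp n M *ᵥ β = 0 → star β ⬝ᵥ (DeltaA n M a *ᵥ (cGreen n M a *ᵥ J)) = star β ⬝ᵥ J :=
  ⟨QvOp_mulVec_cGreen n M a ha, fun J _ hβ => form_DeltaA_cGreen n M a hn ha J hβ⟩

end

end Summit.QuantumFields.BalabanUV.T4Continuum.NE7StraightSliceB5Green
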